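import Literature.MathematicalPhysics.QuantumFieldTheory.Balaban1983to89.B2Ineq338Diamagnetic

/-!
# `Balaban1983to89.B2Eq337ScalarIntegration` — [Balaban1982Higgs2] §3.B pp. 588–591, file 1/3 of the scalar-field
integration chain: the objects of (3.23)/(3.24) ON THE CONCRETE (Higgs)₂,₃ CARRIER and **(3.36) = (3.37)** — «We apply the
formula (3.23) to the underintegral expression. Next we use (3.32) again and it follows that the integral (3.36) is equal
to (3.37)» — PROVED; (3.37) ≤ (3.38) by name

statement-level skeleton of published theorems with citation tags; proofs where landed; nothing here is a claim about the Yang–Mills mass gap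

CITATION HEADER.  T. Bałaban, *(Higgs)₂,₃ quantum fields in a finite volume. II. An upper bound*, Commun. Math. Phys. **86**
(1982) 555–594 [Balaban1982Higgs2] (cell paper B2; PDF held `paper:balaban1982-cmp86-higgs23-ii`, journal page = PDF page
+ 554; pp. 588–591 READ AS IMAGES on the ×2 renders
`run/shared/lean/pub/pub-balaban/b2b-balaban-ref1/pages/1982-cmp86-higgs23-II/1982-cmp86-higgs23-II-p034-x2.png` … `-p037-x2.png`).
Unit `lit-balaban-p15` gen 4 (Phase-2 proof seat p15; HOME `run/shared/lean/pub/lit-balaban/`).  SKELETON row **B2.Eq3.32**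
((3.30)–(3.41); fold owner r02, second readers r14/r13, referee ref-4): residue members **(3.36) = (3.37)**
(ROWS-B2 v2.17: «the (3.23) region bookkeeping is not modelled, so the display (3.37) itself stays absent» — modelled here).
Files 2/3 `…B2Eq325ConcreteSchur` ((3.25) on this carrier) and 3/3 `…B2Ineq339Gathering` ((3.35) → (3.36), (3.39)) import
this one.

WHAT IS PRINTED (verbatim).  p. 588 [PDF 34]: *"Let us write it explicitly, omitting the constants in the definition of
renormalization transformations: ∫dφ₀↾_{Λ₅⁽⁰⁾} exp[−½ Σ_{k=1}^{K} a_k(Lᵏε)^{d−2} Σ_{x_k∈Λ₅⁽ᵏ⁻¹⁾′∩Λ₅⁽ᵏ⁾ᶜ} |φ_k(x_k) −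
(Q_k(Ã^ε)φ₀)(x_k)|² − ½⟨φ₀, (−Δ^ε_{Ã^ε} + m²)φ₀⟩], (3.23) where Λ₅⁽ᴷ⁾ = ∅. … We will consider a configuration Φ defined on
the sum of sets Λ₅⁽⁰⁾ᶜ ∪ ⋃_{k=1}^{K}(Λ₅⁽ᵏ⁻¹⁾′∩Λ₅⁽ᵏ⁾ᶜ) by the formula Φ = Λ₅⁽⁰⁾ᶜφ₀ + Σ_{k=1}^{K}(Λ₅⁽ᵏ⁻¹⁾′∩Λ₅⁽ᵏ⁾ᶜ)φ_k, (3.24)"*;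
p. 589 [PDF 35]: *"and we will write the integral (3.23) in the form (3.23) = Z(Ã^ε)exp(−½⟨Φ, Δ(Ã^ε)Φ⟩). (3.25)"*; p. 590
[PDF 36]: *"The part of it standing on the right of the characteristic functions is equal to Z(Ã^ε)exp(−½⟨Φ, Δ(Ã^ε)Φ⟩),
where all the constants coming from the renormalization transformations are included in Z(Ã^ε)."* … *"using the
normalization properties of the renormalization transformations ∫dφ_{k+l}(y) t^{Lᵏε}_{a_l,L^l,A}(φ_{k+l}(y), φ_k↾_{B^l(y)}) = 1.
(3.32)"* … *"let us denote for simplicity Λ_k = (Λ₅⁽ᵏ⁻¹⁾′∩Λ₅⁽ᵏ⁾ᶜ)₁"*; p. 591 [PDF 37]: *"In the integral over Φ we make the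
transformation Φ = √2Φ′ and we get ∫dΦ′ Z(Ã^ε)exp(−½⟨Φ′, Δ(Ã^ε)Φ′⟩) exp ½log2 Σ_{k=0}^{K}|Λ_k|. (3.36) We apply the formula
(3.23) to the underintegral expression. Next we use (3.32) again and it follows that the integral (3.36) is equal to
∫dφ₀ exp(−½⟨φ₀, (−Δ^ε_{A^ε} + m²)φ₀⟩). (3.37) We apply the "diamagnetic inequality" of paper [I.5] to this integral, and
we estimate it by ∫dφ exp(−½⟨φ, (−Δ^ε + m²)φ⟩) = exp(E_{0,s}). (3.38)"*.

THE CARRIER (concrete; nothing of the tree restated).  The (Higgs)₂,₃ lattice model of `…HiggsLattice`/`…HiggsAveraging`/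
`…HiggsCovariance`: `T_ε = Site P 0`, `T⁽ᵏ⁾ = Site P k`, fields `ScalarField P k N = Site P k → ℝ^N`, the scalar product
(1.5) `siteInner`, the averaging operators `Q_k(Ã) = HiggsCovariance.avgQkLin C Ã k` (= `HiggsAveraging.avgQk` (I.2.11),
`avgQkLin_apply`), `(−Δ^ε_{Ã} + m²) = HiggsCovariance.delta0 C univ Ã m²` ((I.2.17) on the whole torus), the Gaussian kernels
of the k-th order renormalization transformations `B1RT.rtKernel (B1RT.prec a_k (Lᵏε) d)` ((I.2.10); `a_k = B1.aSeq a L k`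
(I.2.15)) whose normalization (I.2.8) = (3.32) is `B1RT.integral_rtKernel_sub`, and p28's `B2Ineq338Diamagnetic.ineq338`
((3.37) ≤ (3.38)) / `E0s`.  REGION DATA (`Regions`): `Λ₅⁽⁰⁾ ⊂ T_ε` (`inner`) and, for k = 1, …, K, `Λ_k ⊂ T⁽ᵏ⁾` (`block`,
↤ the sets Λ₅⁽ᵏ⁻¹⁾′∩Λ₅⁽ᵏ⁾ᶜ of sites of T⁽ᵏ⁾; their nesting geometry (2.5)–(2.8) plays no rôle on pp. 588–591 and is not
imposed).  THE CONFIGURATION Φ of (3.24), *"defined on the sum of sets Λ₅⁽⁰⁾ᶜ ∪ ⋃_k Λ_k"*, is the pair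
`Φ = (φ₀↾_{Λ₅⁽⁰⁾ᶜ}, (φ_k↾_{Λ_k})_k) : Cfg R N = (Λ₅⁽⁰⁾ᶜ → ℝ^N) × ((Σ_k Λ_k) → ℝ^N)` with the Lebesgue measure `dΦ`; the
integration variable of (3.23) is `φ₀↾_{Λ₅⁽⁰⁾} : InCfg R N = (Λ₅⁽⁰⁾ → ℝ^N)`, and `field R Φ.1 u` re-glues `φ₀` on `T_ε`.

WHAT THIS MODULE PROVES (kernel-checked, 0 `sorry`, standard axioms).
§1 (3.23) AS PRINTED: `exponent323` (the displayed exponent), `integral323` (the displayed integral, *"omitting the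
   constants"*), `rtConst` (the omitted constants `Π_k (a_k(Lᵏε)^{d−2}/2π)^{N|Λ_k|/2}`), the density with the constants
   `dens` = `rtConst · exp(exponent323)` (`dens_eq`), and `F325 Φ := ∫dφ₀↾_{Λ₅⁽⁰⁾} dens` = *"Z(Ã^ε)exp(−½⟨Φ, Δ(Ã^ε)Φ⟩),
   where all the constants coming from the renormalization transformations are included in Z(Ã^ε)"* (`F325_eq`:
   `F325 = rtConst · (3.23)`; that it IS such a Gaussian is (3.25), file 2/3).
§2 **(3.36) = (3.37)** (`eq337`): `∫dΦ F325(Φ) = ∫dφ₀ exp(−½⟨φ₀, (−Δ^ε_{Ã}+m²)φ₀⟩)` — *"We apply the formula (3.23) to the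
   underintegral expression. Next we use (3.32) again"*: Tonelli, the normalization (3.32) at every block site
   (`integral_blockKernels`, `lintegral_dens_block`), and re-gluing `φ₀↾_{Λ₅⁽⁰⁾}` with `φ₀↾_{Λ₅⁽⁰⁾ᶜ}` into `dφ₀` (Mathlib
   `volume_preserving_piEquivPiSubtypeProd`; `lintegral_dens`).  No hypothesis on the regions or on `Ã^ε`.
§3 **(3.37) ≤ (3.38)** by name: `integral_F325_le` — `∫dΦ F325(Φ) ≤ exp(E_{0,s})` (`B2Ineq338Diamagnetic.ineq338`, p28).
HONEST SCOPE.  (3.35) (the use of Proposition 3.1 and of the large-field factors (3.31)/(3.33)/(3.34)) is not derived in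
this chain (it is the hypothesis of (3.39) in file 3/3); (3.40) is not touched; no nesting/separation property of the
regions is used or asserted.
-/

noncomputable section

open MeasureTheory Finset Real
open scoped BigOperators ENNReal InnerProductSpace

namespace Literature.MathematicalPhysics.QuantumFieldTheory.Balaban1983to89.B2Eq337ScalarIntegration

open Literature.MathematicalPhysics.QuantumFieldTheory.Balaban1983to89.HiggsLattice
open Literature.MathematicalPhysics.QuantumFieldTheory.Balaban1983to89.HiggsAveraging
open Literature.MathematicalPhysics.QuantumFieldTheory.Balaban1983to89.HiggsCovariance
open Literature.MathematicalPhysics.QuantumFieldTheory.Balaban1983to89.HiggsCovariancePos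
open Literature.MathematicalPhysics.QuantumFieldTheory.Balaban1983to89.B2Ineq338Diamagnetic

/-! ## §0 The carrier of (3.23)/(3.24): regions, the configuration `Φ`, the re-glued field `φ₀` -/

/-- The value space `ℝ^N` of the scalar fields ([Balaban1982Higgs1] p. 604). [cite: Balaban1982Higgs2, (3.23) p.588] -/
abbrev V (N : ℕ) : Type := EuclideanSpace ℝ (Fin N)

/-- The region data of (3.23)/(3.24): `Λ₅⁽⁰⁾ ⊂ T_ε` (the set integrated over in (3.23)) and, for `k = 1, …, K`, the sets
`Λ_k = Λ₅⁽ᵏ⁻¹⁾′ ∩ Λ₅⁽ᵏ⁾ᶜ` of sites of `T⁽ᵏ⁾` carrying the fields `φ_k` (index `j : Fin K` ↤ `k = j + 1`).  Arbitrary finite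
sets: the nesting geometry of (2.5)–(2.8) is not needed on pp. 588–591. [cite: Balaban1982Higgs2, (3.23)–(3.24) p.588] -/
structure Regions (P : HiggsLattice.Params) (K : ℕ) where
  /-- `Λ₅⁽⁰⁾ ⊂ T_ε`. [cite: Balaban1982Higgs2, (3.23) p.588] -/
  inner : Finset (HiggsLattice.Site P 0)
  /-- `Λ_{j+1} ⊂ T⁽ʲ⁺¹⁾`, `j : Fin K`. [cite: Balaban1982Higgs2, (3.24) p.588] -/
  block : (j : Fin K) → Finset (HiggsLattice.Site P (j.val + 1))

namespace Regions

variable {P : HiggsLattice.Params} {K : ℕ} (R : Regions P K)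

/-- Membership in `Λ₅⁽⁰⁾` as the splitting predicate of `T_ε = Λ₅⁽⁰⁾ ∪ Λ₅⁽⁰⁾ᶜ`. [cite: Balaban1982Higgs2, (3.24) p.588] -/
def isIn (x : HiggsLattice.Site P 0) : Prop := x ∈ R.inner

/-- Decidability of the splitting predicate. [folklore] [cite: Balaban1982Higgs2, (3.24) p.588] -/
instance instDecidablePredIsIn : DecidablePred R.isIn := fun x => inferInstanceAs (Decidable (x ∈ R.inner))

/-- The sites of `Λ₅⁽⁰⁾` (the integration variable `φ₀↾_{Λ₅⁽⁰⁾}` of (3.23) lives on them). [cite: Balaban1982Higgs2, (3.23) p.588] -/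
abbrev InSite : Type := {x : HiggsLattice.Site P 0 // R.isIn x}

/-- The sites of `Λ₅⁽⁰⁾ᶜ` (the `φ₀`-part of `Φ` in (3.24)). [cite: Balaban1982Higgs2, (3.24) p.588] -/
abbrev OutSite : Type := {x : HiggsLattice.Site P 0 // ¬ R.isIn x}

/-- The disjoint union `⋃_{k=1}^{K} Λ_k` of the block regions, a site of it remembering its level (the `φ_k`-part of `Φ`
in (3.24)). [cite: Balaban1982Higgs2, (3.24) p.588] -/
abbrev BlockSite : Type := Σ j : Fin K, {y : HiggsLattice.Site P (j.val + 1) // y ∈ R.block j}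

/-- The level `k = j + 1 ∈ {1, …, K}` of a block site. [cite: Balaban1982Higgs2, (3.24) p.588] -/
abbrev lvl (s : R.BlockSite) : ℕ := s.1.val + 1

end Regions

variable {P : HiggsLattice.Params} {N K : ℕ}

/-- **(3.24)** p. 588: the configuration `Φ = Λ₅⁽⁰⁾ᶜφ₀ + Σ_{k=1}^{K} Λ_kφ_k` *"defined on the sum of sets
Λ₅⁽⁰⁾ᶜ ∪ ⋃_{k=1}^{K} Λ_k"*, as the pair `(φ₀↾_{Λ₅⁽⁰⁾ᶜ}, (φ_k↾_{Λ_k})_{k=1}^{K})`; `dΦ` = Lebesgue (product) measure.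
[cite: Balaban1982Higgs2, (3.24) p.588] -/
abbrev Cfg (R : Regions P K) (N : ℕ) : Type := (R.OutSite → V N) × (R.BlockSite → V N)

/-- The integration variable `φ₀↾_{Λ₅⁽⁰⁾}` of (3.23). [cite: Balaban1982Higgs2, (3.23) p.588] -/
abbrev InCfg (R : Regions P K) (N : ℕ) : Type := R.InSite → V N

/-- Lebesgue measure on the configurations `Φ` is an additive Haar measure (product of the Lebesgue measures of the two
parts) — needed for the substitution `Φ = √2Φ′` of (3.36). [folklore] [cite: Balaban1982Higgs2, (3.36) p.591] -/
instance instIsAddHaarMeasureCfg (R : Regions P K) (N : ℕ) : (volume : Measure (Cfg R N)).IsAddHaarMeasure :=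
  Measure.prod.instIsAddHaarMeasure _ _

/-- Re-gluing `φ₀ = Λ₅⁽⁰⁾ᶜφ₀ + Λ₅⁽⁰⁾φ₀` on `T_ε` from its two parts (the `φ₀`-part of `Φ` and the integration variable of
(3.23)). [cite: Balaban1982Higgs2, (3.23)–(3.24) p.588] -/
def field (R : Regions P K) (φout : R.OutSite → V N) (u : InCfg R N) : ScalarField P 0 N :=
  fun x => if h : R.isIn x then u ⟨x, h⟩ else φout ⟨x, h⟩

/-- On `Λ₅⁽⁰⁾` the re-glued field is the integration variable. [cite: Balaban1982Higgs2, (3.23) p.588] -/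
@[simp] theorem field_apply_in (R : Regions P K) (φout : R.OutSite → V N) (u : InCfg R N) (i : R.InSite) :
    field R φout u i = u i := by
  simp [field, i.2]

/-- On `Λ₅⁽⁰⁾ᶜ` the re-glued field is the `φ₀`-part of `Φ`. [cite: Balaban1982Higgs2, (3.24) p.588] -/
@[simp] theorem field_apply_out (R : Regions P K) (φout : R.OutSite → V N) (u : InCfg R N) (o : R.OutSite) :
    field R φout u o = φout o := by
  simp [field, o.2]

/-- The re-gluing IS the inverse of Mathlib's measurable splitting `(T_ε → ℝ^N) ≃ᵐ (Λ₅⁽⁰⁾ → ℝ^N) × (Λ₅⁽⁰⁾ᶜ → ℝ^N)`.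
[folklore] [cite: Balaban1982Higgs2, (3.24) p.588] -/
theorem splitEquiv_symm_apply (R : Regions P K) (q : InCfg R N × (R.OutSite → V N)) :
    (MeasurableEquiv.piEquivPiSubtypeProd (fun _ : HiggsLattice.Site P 0 => V N) R.isIn).symm q
      = field R q.2 q.1 := by
  funext x
  rfl

/-- The re-gluing pushes `dφ₀↾_{Λ₅⁽⁰⁾} × dφ₀↾_{Λ₅⁽⁰⁾ᶜ}` to `dφ₀` (Mathlib `volume_preserving_piEquivPiSubtypeProd`).
[folklore] [cite: Balaban1982Higgs2, (3.24) p.588] -/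
theorem measurePreserving_field (R : Regions P K) :
    MeasurePreserving (fun q : InCfg R N × (R.OutSite → V N) => field R q.2 q.1) volume volume := by
  have h := (volume_preserving_piEquivPiSubtypeProd (fun _ : HiggsLattice.Site P 0 => V N) R.isIn).symm _
  have hfun : (fun q : InCfg R N × (R.OutSite → V N) => field R q.2 q.1)
      = ⇑(MeasurableEquiv.piEquivPiSubtypeProd (fun _ : HiggsLattice.Site P 0 => V N) R.isIn).symm := by
    funext q
    exact (splitEquiv_symm_apply R q).symm
  rw [hfun]
  exact h

/-- The re-gluing is jointly continuous (it is linear). [folklore] [cite: Balaban1982Higgs2, (3.24) p.588] -/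
theorem continuous_field (R : Regions P K) :
    Continuous (fun q : (R.OutSite → V N) × InCfg R N => field R q.1 q.2) := by
  refine continuous_pi fun x => ?_
  by_cases h : R.isIn x
  · simp only [field, h, dite_true]
    exact (continuous_apply _).comp continuous_snd
  · simp only [field, h, dite_false]
    exact (continuous_apply _).comp continuous_fst

/-! ## §1 (3.23) as printed, the omitted constants, and `Z(Ã^ε)exp(−½⟨Φ, Δ(Ã^ε)Φ⟩)` with the constants included -/

/-- The precision `a_k(Lᵏε)^{d−2}` of the k-th order renormalization transformation ((I.2.10); `a_k = B1.aSeq a L k`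
(I.2.15), `Lᵏε = P.mesh k`): the tree's `B1RT.prec`. [cite: Balaban1982Higgs2, (3.23) p.588] -/
def precAt (P : HiggsLattice.Params) (a : ℝ) (k : ℕ) : ℝ := B1RT.prec (B1.aSeq a P.L k) (P.mesh k) P.d

/-- `a_k(Lᵏε)^{d−2} > 0` for `a > 0`, `L > 1`, `k ≥ 1`. [cite: Balaban1982Higgs2, (3.23) p.588] -/
theorem precAt_pos {a : ℝ} (ha : 0 < a) (hL : 1 < P.L) {k : ℕ} (hk : 1 ≤ k) : 0 < precAt P a k := by
  have hL' : (1 : ℝ) < P.L := by exact_mod_cast hL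
  exact B1RT.prec_pos (B1.aSeq_pos ha hL' hk) (P.mesh_pos k) P.d

/-- `(Q_k(Ã^ε)φ₀)(x_k)` for a block site `x_k ∈ Λ_k` (the averaging operator (I.2.11) of the tree, `avgQkLin` =
`avgQk`). [cite: Balaban1982Higgs2, (3.23) p.588] -/
def qMean (C : ChargeData N) (A : HiggsLattice.VecField P 0) (R : Regions P K) (φ₀ : ScalarField P 0 N)
    (s : R.BlockSite) : V N :=
  avgQkLin C A (R.lvl s) φ₀ s.2.val

/-- `qMean` is the tree's `(Q_k(Ã)φ₀)(x_k)` = `HiggsAveraging.avgQk`. [cite: Balaban1982Higgs2, (3.23) p.588] -/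
theorem qMean_eq_avgQk (C : ChargeData N) (A : HiggsLattice.VecField P 0) (R : Regions P K) (φ₀ : ScalarField P 0 N)
    (s : R.BlockSite) : qMean C A R φ₀ s = avgQk C A (R.lvl s) φ₀ s.2.val := by
  rw [qMean, avgQkLin_apply]

/-- The last factor of (3.22)/(3.23): `exp(−½⟨φ₀, (−Δ^ε_{Ã^ε} + m²)φ₀⟩)` on the whole torus `T_ε` — verbatim the
integrand of p28's (3.37) (`B2Ineq338Diamagnetic.ineq338`: `delta0 C univ Ã m²` = `−Δ^ε_{Ã} + m²`).
[cite: Balaban1982Higgs2, (3.23) p.588, (3.37) p.591] -/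
def gField (C : ChargeData N) (A : HiggsLattice.VecField P 0) (msq : ℝ) (φ₀ : ScalarField P 0 N) : ℝ :=
  Real.exp (-(1/2 : ℝ) * siteInner φ₀ (delta0 C Finset.univ A msq φ₀))

/-- **The exponent of (3.23)** p. 588, verbatim:
`−½ Σ_{k=1}^{K} a_k(Lᵏε)^{d−2} Σ_{x_k∈Λ_k} |φ_k(x_k) − (Q_k(Ã^ε)φ₀)(x_k)|² − ½⟨φ₀, (−Δ^ε_{Ã^ε} + m²)φ₀⟩`, as a function of
the configuration `Φ` (3.24) and of the integration variable `φ₀↾_{Λ₅⁽⁰⁾}` (`φ₀` re-glued by `field`).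
[cite: Balaban1982Higgs2, (3.23) p.588] -/
def exponent323 (R : Regions P K) (C : ChargeData N) (a : ℝ) (A : HiggsLattice.VecField P 0) (msq : ℝ)
    (Φ : Cfg R N) (u : InCfg R N) : ℝ :=
  -(1/2 : ℝ) * (∑ s : R.BlockSite, precAt P a (R.lvl s) * ‖Φ.2 s - qMean C A R (field R Φ.1 u) s‖ ^ 2)
    - (1/2 : ℝ) * siteInner (field R Φ.1 u) (delta0 C Finset.univ A msq (field R Φ.1 u))

/-- **(3.23)** p. 588, verbatim (*"omitting the constants in the definition of renormalization transformations"*):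
`∫dφ₀↾_{Λ₅⁽⁰⁾} exp[exponent (3.23)]`. [cite: Balaban1982Higgs2, (3.23) p.588] -/
def integral323 (R : Regions P K) (C : ChargeData N) (a : ℝ) (A : HiggsLattice.VecField P 0) (msq : ℝ)
    (Φ : Cfg R N) : ℝ :=
  ∫ u : InCfg R N, Real.exp (exponent323 R C a A msq Φ u)

/-- The constants omitted in (3.23): `Π_{k=1}^{K} Π_{x_k∈Λ_k} (a_k(Lᵏε)^{d−2}/2π)^{N/2}` (the prefactors of the kernels
(I.2.10)). [cite: Balaban1982Higgs2, (3.23) p.588] -/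
def rtConst (R : Regions P K) (N : ℕ) (a : ℝ) : ℝ :=
  ∏ s : R.BlockSite, (precAt P a (R.lvl s) / (2 * π)) ^ ((N : ℝ) / 2)

/-- The integrand of (3.23) WITH the constants of the renormalization transformations: the product over the block sites
of the Gaussian kernels (I.2.10) `t_{a_k(Lᵏε)^{d−2}}(φ_k(x_k) − (Q_k(Ã^ε)φ₀)(x_k))` (`B1RT.rtKernel`) times
`exp(−½⟨φ₀, (−Δ^ε_{Ã^ε} + m²)φ₀⟩)`. [cite: Balaban1982Higgs2, (3.23) p.588] -/
def dens (R : Regions P K) (C : ChargeData N) (a : ℝ) (A : HiggsLattice.VecField P 0) (msq : ℝ)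
    (Φ : Cfg R N) (u : InCfg R N) : ℝ :=
  (∏ s : R.BlockSite, B1RT.rtKernel (precAt P a (R.lvl s)) (Φ.2 s - qMean C A R (field R Φ.1 u) s))
    * gField C A msq (field R Φ.1 u)

/-- **p. 590**: *"The part of it standing on the right of the characteristic functions is equal to
Z(Ã^ε)exp(−½⟨Φ, Δ(Ã^ε)Φ⟩), where all the constants coming from the renormalization transformations are included in
Z(Ã^ε)"* — the integral (3.23) with the constants, as a function of `Φ` (that it IS a Gaussian `Z e^{−½⟨Φ,ΔΦ⟩}` is (3.25),
`eq325_concrete` below). [cite: Balaban1982Higgs2, (3.25) p.589] -/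
def F325 (R : Regions P K) (C : ChargeData N) (a : ℝ) (A : HiggsLattice.VecField P 0) (msq : ℝ) (Φ : Cfg R N) : ℝ :=
  ∫ u : InCfg R N, dens R C a A msq Φ u

section Densities

variable (R : Regions P K) (C : ChargeData N) (a : ℝ) (A : HiggsLattice.VecField P 0) (msq : ℝ)

/-- `finrank ℝ ℝ^N = N`. [folklore] [cite: Balaban1982Higgs2, (3.23) p.588] -/
theorem finrank_V : Module.finrank ℝ (V N) = N := by
  simp

/-- The density with constants is `(constants) × exp(exponent (3.23))`. [cite: Balaban1982Higgs2, (3.23) p.588] -/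
theorem dens_eq (Φ : Cfg R N) (u : InCfg R N) :
    dens R C a A msq Φ u = rtConst R N a * Real.exp (exponent323 R C a A msq Φ u) := by
  unfold dens rtConst exponent323 gField
  simp only [B1RT.rtKernel_eq, finrank_V]
  rw [Finset.prod_mul_distrib, ← Real.exp_sum, mul_assoc, ← Real.exp_add]
  congr 2
  rw [Finset.mul_sum]
  simp only [sub_eq_add_neg, neg_mul]
  refine congrArg₂ _ (Finset.sum_congr rfl fun s _ => by ring) rfl

/-- `F325 = (constants) × (3.23)`. [cite: Balaban1982Higgs2, (3.25) p.589] -/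
theorem F325_eq (Φ : Cfg R N) :
    F325 R C a A msq Φ = rtConst R N a * integral323 R C a A msq Φ := by
  unfold F325 integral323
  simp_rw [dens_eq]
  exact integral_const_mul _ _

/-- The density is non-negative. [cite: Balaban1982Higgs2, (3.23) p.588] -/
theorem dens_nonneg {a : ℝ} (ha : 0 < a) (hL : 1 < P.L) (Φ : Cfg R N) (u : InCfg R N) :
    0 ≤ dens R C a A msq Φ u :=
  mul_nonneg (Finset.prod_nonneg fun _ _ => B1RT.rtKernel_nonneg (precAt_pos ha hL (Nat.le_add_left 1 _)).le _)
    (Real.exp_nonneg _)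

/-- `F325 ≥ 0`. [cite: Balaban1982Higgs2, (3.25) p.589] -/
theorem F325_nonneg {a : ℝ} (ha : 0 < a) (hL : 1 < P.L) (Φ : Cfg R N) : 0 ≤ F325 R C a A msq Φ :=
  integral_nonneg fun u => dens_nonneg R C A msq ha hL Φ u

/-- `Q_k(Ã^ε)` evaluated at a block site is continuous in `φ₀` (linear on a finite-dimensional space).
[folklore] [cite: Balaban1982Higgs2, (3.23) p.588] -/
theorem continuous_qMean (s : R.BlockSite) : Continuous (fun φ₀ : ScalarField P 0 N => qMean C A R φ₀ s) :=
  (continuous_apply _).comp (avgQkLin C A (R.lvl s)).continuous_of_finiteDimensional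

/-- `exp(−½⟨φ₀, (−Δ^ε_{Ã}+m²)φ₀⟩)` is continuous in `φ₀`. [folklore] [cite: Balaban1982Higgs2, (3.37) p.591] -/
theorem continuous_gField : Continuous (gField C A msq : ScalarField P 0 N → ℝ) := by
  unfold gField siteInner
  refine Real.continuous_exp.comp (continuous_const.mul (continuous_finsetSum _ fun x _ => ?_))
  exact continuous_const.mul
    ((continuous_apply x).inner ((continuous_apply x).comp (delta0 C Finset.univ A msq).continuous_of_finiteDimensional))

/-- The density is jointly continuous in `(Φ, φ₀↾_{Λ₅⁽⁰⁾})`. [folklore] [cite: Balaban1982Higgs2, (3.23) p.588] -/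
theorem continuous_dens : Continuous (fun p : Cfg R N × InCfg R N => dens R C a A msq p.1 p.2) := by
  have hf : Continuous (fun p : Cfg R N × InCfg R N => field R p.1.1 p.2) :=
    (continuous_field R).comp (continuous_fst.fst.prodMk continuous_snd)
  refine Continuous.mul (continuous_finsetProd _ fun s _ => ?_) ((continuous_gField C A msq).comp hf)
  exact (B1RT.continuous_rtKernel _).comp
    (((continuous_apply s).comp continuous_fst.snd).sub ((continuous_qMean R C A s).comp hf))

/-- The density at a fixed `φ₀↾_{Λ₅⁽⁰⁾ᶜ}` is jointly continuous in `((φ_k)_k, φ₀↾_{Λ₅⁽⁰⁾})`. [folklore]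
[cite: Balaban1982Higgs2, (3.23) p.588] -/
theorem continuous_dens_section (φout : R.OutSite → V N) :
    Continuous (fun p : (R.BlockSite → V N) × InCfg R N => dens R C a A msq (φout, p.1) p.2) := by
  have hf : Continuous (fun p : (R.BlockSite → V N) × InCfg R N => field R φout p.2) :=
    (continuous_field R).comp (continuous_const.prodMk continuous_snd)
  refine Continuous.mul (continuous_finsetProd _ fun s _ => ?_) ((continuous_gField C A msq).comp hf)
  exact (B1RT.continuous_rtKernel _).comp
    (((continuous_apply s).comp continuous_fst).sub ((continuous_qMean R C A s).comp hf))

end Densities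

/-! ## §2 (3.36) = (3.37): *"We apply the formula (3.23) to the underintegral expression. Next we use (3.32) again"* -/

section Eq337

variable (R : Regions P K) (C : ChargeData N) {a : ℝ} (A : HiggsLattice.VecField P 0) {msq : ℝ}

/-- **(3.32) at every block site** — *"Next we use (3.32) again"*: for fixed centres `c`,
`∫ Π_k Π_{x_k∈Λ_k} dφ_k(x_k) Π t_{a_k(Lᵏε)^{d−2}}(φ_k(x_k) − c(x_k)) = 1` (the tree's (I.2.8) `B1RT.integral_rtKernel_sub`
at each site, Fubini over the finite product). [cite: Balaban1982Higgs2, (3.32) p.590] -/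
theorem integral_blockKernels (ha : 0 < a) (hL : 1 < P.L) (c : R.BlockSite → V N) :
    ∫ ψ : R.BlockSite → V N, ∏ s, B1RT.rtKernel (precAt P a (R.lvl s)) (ψ s - c s) = 1 := by
  have h := integral_fintype_prod_volume_eq_prod (𝕜 := ℝ)
    (fun (s : R.BlockSite) (v : V N) => B1RT.rtKernel (precAt P a (R.lvl s)) (v - c s))
  simp only [B1RT.integral_rtKernel_sub (precAt_pos ha hL (Nat.le_add_left 1 _)), Finset.prod_const_one] at h
  exact h

/-- (3.32) at every block site, Lebesgue-integral form: `∫⁻ Π t = 1`. [cite: Balaban1982Higgs2, (3.32) p.590] -/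
theorem lintegral_blockKernels (ha : 0 < a) (hL : 1 < P.L) (c : R.BlockSite → V N) :
    ∫⁻ ψ : R.BlockSite → V N, ENNReal.ofReal (∏ s, B1RT.rtKernel (precAt P a (R.lvl s)) (ψ s - c s)) = 1 := by
  have hnn : ∀ ψ : R.BlockSite → V N, 0 ≤ ∏ s, B1RT.rtKernel (precAt P a (R.lvl s)) (ψ s - c s) :=
    fun ψ => Finset.prod_nonneg fun s _ => B1RT.rtKernel_nonneg (precAt_pos ha hL (Nat.le_add_left 1 _)).le _
  have hint : Integrable (fun ψ : R.BlockSite → V N => ∏ s, B1RT.rtKernel (precAt P a (R.lvl s)) (ψ s - c s)) :=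
    Integrable.of_integral_ne_zero (by rw [integral_blockKernels R ha hL c]; exact one_ne_zero)
  rw [← ofReal_integral_eq_lintegral_ofReal hint (ae_of_all _ hnn), integral_blockKernels R ha hL c, ENNReal.ofReal_one]

/-- The Gaussian `exp(−½⟨φ₀,(−Δ^ε_{Ã}+m²)φ₀⟩)` is integrable over `dφ₀` (`m² > 0`; p28's positive Gaussian integral).
[cite: Balaban1982Higgs2, (3.37) p.591] -/
theorem integrable_gField (hmsq : 0 < msq) : Integrable (gField C A msq : ScalarField P 0 N → ℝ) := by
  refine Integrable.of_integral_ne_zero ?_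
  have h := integral_exp_neg_half_covMass_pos (P := P) (k := 0) C Finset.univ A hmsq
  unfold gField
  simp_rw [delta0_apply]
  exact h.ne'

/-- The product of the block kernels at fixed centres is continuous (hence measurable) in the block fields.
[folklore] [cite: Balaban1982Higgs2, (3.32) p.590] -/
theorem continuous_blockKernels (a : ℝ) (c : R.BlockSite → V N) :
    Continuous (fun ψ : R.BlockSite → V N => ∏ s, B1RT.rtKernel (precAt P a (R.lvl s)) (ψ s - c s)) :=
  continuous_finsetProd _ fun s _ => (B1RT.continuous_rtKernel _).comp ((continuous_apply s).sub continuous_const)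

/-- For a fixed `φ₀↾_{Λ₅⁽⁰⁾ᶜ}` and a fixed `φ₀↾_{Λ₅⁽⁰⁾}`, integrating the density over the block fields `φ_k` leaves
`exp(−½⟨φ₀,(−Δ_{Ã}+m²)φ₀⟩)` — (3.32) at every block site. [cite: Balaban1982Higgs2, (3.32) p.590, (3.37) p.591] -/
theorem lintegral_dens_block (ha : 0 < a) (hL : 1 < P.L) (φout : R.OutSite → V N) (u : InCfg R N) :
    ∫⁻ ψ : R.BlockSite → V N, ENNReal.ofReal (dens R C a A msq (φout, ψ) u)
      = ENNReal.ofReal (gField C A msq (field R φout u)) := by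
  have hκ : ∀ s : R.BlockSite, 0 < precAt P a (R.lvl s) := fun s => precAt_pos ha hL (Nat.le_add_left 1 _)
  set c : R.BlockSite → V N := fun s => qMean C A R (field R φout u) s with hc
  have hnn : ∀ ψ : R.BlockSite → V N, 0 ≤ ∏ s, B1RT.rtKernel (precAt P a (R.lvl s)) (ψ s - c s) :=
    fun ψ => Finset.prod_nonneg fun s _ => B1RT.rtKernel_nonneg (hκ s).le _
  have hsplit : ∀ ψ : R.BlockSite → V N, ENNReal.ofReal (dens R C a A msq (φout, ψ) u)
      = ENNReal.ofReal (∏ s, B1RT.rtKernel (precAt P a (R.lvl s)) (ψ s - c s))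
        * ENNReal.ofReal (gField C A msq (field R φout u)) := by
    intro ψ
    have hd : dens R C a A msq (φout, ψ) u
        = (∏ s, B1RT.rtKernel (precAt P a (R.lvl s)) (ψ s - c s)) * gField C A msq (field R φout u) := rfl
    rw [hd, ENNReal.ofReal_mul (hnn ψ)]
  simp_rw [hsplit]
  have hmk : Measurable (fun ψ : R.BlockSite → V N =>
      ENNReal.ofReal (∏ s, B1RT.rtKernel (precAt P a (R.lvl s)) (ψ s - c s))) :=
    ENNReal.measurable_ofReal.comp (continuous_blockKernels R a c).measurable
  rw [lintegral_mul_const _ hmk, lintegral_blockKernels R ha hL c, one_mul]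

/-- **The computation behind (3.36) = (3.37)**, Lebesgue-integral form:
`∫⁻dΦ ∫⁻dφ₀↾_{Λ₅⁽⁰⁾} (Π_k t)·e^{−½⟨φ₀,(−Δ_{Ã}+m²)φ₀⟩} = ∫⁻dφ₀ e^{−½⟨φ₀,(−Δ_{Ã}+m²)φ₀⟩}` — Tonelli over
`dΦ = dφ₀↾_{Λ₅⁽⁰⁾ᶜ} dΠφ_k`, (3.32) in the `φ_k`, re-gluing `dφ₀↾_{Λ₅⁽⁰⁾ᶜ} dφ₀↾_{Λ₅⁽⁰⁾} = dφ₀`.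
[cite: Balaban1982Higgs2, (3.37) p.591] -/
theorem lintegral_dens (ha : 0 < a) (hL : 1 < P.L) :
    ∫⁻ Φ : Cfg R N, ∫⁻ u : InCfg R N, ENNReal.ofReal (dens R C a A msq Φ u)
      = ∫⁻ φ₀ : ScalarField P 0 N, ENNReal.ofReal (gField C A msq φ₀) := by
  have hH : Measurable (fun p : Cfg R N × InCfg R N => ENNReal.ofReal (dens R C a A msq p.1 p.2)) :=
    ENNReal.measurable_ofReal.comp (continuous_dens R C a A msq).measurable
  -- Step 1: dΦ = dφ₀↾Λ₅⁰ᶜ dΠφ_k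
  have hG : Measurable (fun Φ : Cfg R N => ∫⁻ u : InCfg R N, ENNReal.ofReal (dens R C a A msq Φ u)) :=
    hH.lintegral_prod_right'
  rw [Measure.volume_eq_prod, lintegral_prod _ hG.aemeasurable]
  -- Step 2: for fixed φ₀↾Λ₅⁰ᶜ, swap dΠφ_k with dφ₀↾Λ₅⁰ and use (3.32) in the φ_k
  have hstep : ∀ φout : R.OutSite → V N,
      ∫⁻ ψ : R.BlockSite → V N, ∫⁻ u : InCfg R N, ENNReal.ofReal (dens R C a A msq (φout, ψ) u)
        = ∫⁻ u : InCfg R N, ENNReal.ofReal (gField C A msq (field R φout u)) := by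
    intro φout
    have hmeas : Measurable (fun p : (R.BlockSite → V N) × InCfg R N =>
        ENNReal.ofReal (dens R C a A msq (φout, p.1) p.2)) :=
      ENNReal.measurable_ofReal.comp (continuous_dens_section R C a A msq φout).measurable
    rw [lintegral_lintegral_swap (f := fun (ψ : R.BlockSite → V N) (u : InCfg R N) =>
      ENNReal.ofReal (dens R C a A msq (φout, ψ) u)) hmeas.aemeasurable]
    exact lintegral_congr fun u => lintegral_dens_block R C A ha hL φout u
  simp_rw [hstep]
  -- Step 3: dφ₀↾Λ₅⁰ᶜ dφ₀↾Λ₅⁰ = dφ₀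
  have hg : Measurable (fun φ₀ : ScalarField P 0 N => ENNReal.ofReal (gField C A msq φ₀)) :=
    ENNReal.measurable_ofReal.comp (continuous_gField C A msq).measurable
  have hmeasq : Measurable (fun q : InCfg R N × (R.OutSite → V N) =>
      ENNReal.ofReal (gField C A msq (field R q.2 q.1))) :=
    hg.comp (measurePreserving_field (N := N) R).measurable
  rw [← (measurePreserving_field (N := N) R).lintegral_comp hg, Measure.volume_eq_prod,
    lintegral_prod (fun q : InCfg R N × (R.OutSite → V N) => ENNReal.ofReal (gField C A msq (field R q.2 q.1)))
      hmeasq.aemeasurable]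
  have hmeas2 : Measurable (fun q : (R.OutSite → V N) × InCfg R N =>
      ENNReal.ofReal (gField C A msq (field R q.1 q.2))) :=
    hg.comp (continuous_field R).measurable
  rw [lintegral_lintegral_swap (f := fun (φout : R.OutSite → V N) (u : InCfg R N) =>
      ENNReal.ofReal (gField C A msq (field R φout u))) hmeas2.aemeasurable]

/-- **(3.36) = (3.37)** p. 591: *"We apply the formula (3.23) to the underintegral expression. Next we use (3.32) again
and it follows that the integral (3.36) is equal to ∫dφ₀ exp(−½⟨φ₀, (−Δ^ε_{A^ε} + m²)φ₀⟩). (3.37)"* — with the underintegral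
expression `Z(Ã^ε)exp(−½⟨Φ′,Δ(Ã^ε)Φ′⟩)` = the integral (3.23) with its constants (`F325`):
`∫dΦ′ F325(Φ′) = ∫dφ₀ exp(−½⟨φ₀,(−Δ^ε_{Ã^ε}+m²)φ₀⟩)`. PROVED (no hypothesis on the regions or on `Ã^ε`).
[cite: Balaban1982Higgs2, (3.37) p.591] -/
theorem eq337 (ha : 0 < a) (hL : 1 < P.L) (hmsq : 0 < msq) :
    ∫ Φ : Cfg R N, F325 R C a A msq Φ
      = ∫ φ₀ : ScalarField P 0 N, Real.exp (-(1/2 : ℝ) * siteInner φ₀ (delta0 C Finset.univ A msq φ₀)) := by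
  have hH : Measurable (fun p : Cfg R N × InCfg R N => ENNReal.ofReal (dens R C a A msq p.1 p.2)) :=
    ENNReal.measurable_ofReal.comp (continuous_dens R C a A msq).measurable
  have hG : Measurable (fun Φ : Cfg R N => ∫⁻ u : InCfg R N, ENNReal.ofReal (dens R C a A msq Φ u)) :=
    hH.lintegral_prod_right'
  have hF : ∀ Φ : Cfg R N, F325 R C a A msq Φ
      = (∫⁻ u : InCfg R N, ENNReal.ofReal (dens R C a A msq Φ u)).toReal := fun Φ =>
    integral_eq_lintegral_of_nonneg_ae (ae_of_all _ (dens_nonneg R C A msq ha hL Φ))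
      ((continuous_dens R C a A msq).comp (continuous_const.prodMk continuous_id)).aestronglyMeasurable
  have hgint := integrable_gField C A hmsq (N := N) (P := P)
  have hfin : ∫⁻ Φ : Cfg R N, ∫⁻ u : InCfg R N, ENNReal.ofReal (dens R C a A msq Φ u) ≠ ∞ := by
    rw [lintegral_dens R C A ha hL, ← ofReal_integral_eq_lintegral_ofReal hgint
      (ae_of_all _ fun φ₀ => Real.exp_nonneg _)]
    exact ENNReal.ofReal_ne_top
  simp_rw [hF]
  rw [integral_toReal hG.aemeasurable (ae_lt_top hG hfin), lintegral_dens R C A ha hL]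
  exact (integral_eq_lintegral_of_nonneg_ae (ae_of_all _ fun φ₀ => Real.exp_nonneg _)
    (continuous_gField C A msq).aestronglyMeasurable).symm

/-! ## §3 (3.37) ≤ (3.38) by name -/

/-- **(3.36) = (3.37) ≤ (3.38)** p. 591: `∫dΦ′ F325(Φ′) ≤ exp(E_{0,s})` — `eq337` followed by p28's diamagnetic step
`B2Ineq338Diamagnetic.ineq338` (BFS [I.5], Gaussian case) and (3.38) `eq338`.
[cite: Balaban1982Higgs2, (3.37)–(3.38) p.591] -/
theorem integral_F325_le (ha : 0 < a) (hL : 1 < P.L) (hmsq : 0 < msq) :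
    ∫ Φ : Cfg R N, F325 R C a A msq Φ ≤ Real.exp (E0s P C msq) := by
  rw [eq337 R C A ha hL hmsq]
  exact ineq338 C A hmsq

end Eq337

end Literature.MathematicalPhysics.QuantumFieldTheory.Balaban1983to89.B2Eq337ScalarIntegration
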